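import Literature.LinearAlgebra.TensorNetworks.QTTLaplaceMulti

/-!
# Explicit low-rank QTT representations of the Neumann and periodic Laplacians and their
# terminal rank reductions (Kazeev–Khoromskij, Lem. 2.2 completed; Thm. 4.1, one dimension)

This file completes the formalisation of LEMMA 2.2 of the cited paper begun in
`Literature.LinearAlgebra.TensorNetworks.QTTLaplace` (which has the rank-`3` Dirichlet Laplacian
`Δ_DD^{(d)}` of Lem. 2.1, the rank-`4` mixed matrices `Δ_DN^{(d)}`, `Δ_ND^{(d)}` and the rank-`5`
representation of the periodic Laplacian `Δ_P^{(d)}` from the proof of Lem. 2.2, all in uniform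
train form), with the blocks `I, J, J' = Jᵀ, I₁, I₂, P = J + J'` of eq. (7) and the rank-`3` core
`W = [I J' J; 0 J 0; 0 0 J']` of Lem. 2.1:

* (EQ. (4), PROOF OF LEM. 2.2) THE NEUMANN LAPLACIAN `Δ_NN^{(d)}` — `tridiag(-1, 2, -1)` with the
  first AND the last diagonal entries lowered to `1` (`laplaceNN`) — and its rank-`5` representation
  `Δ_NN^{(d)} = Δ_DD^{(d)} - I₁^{⊗d} - I₂^{⊗d} =
   [I J' J I₂ I₁] ⋈ diag(W, I₂, I₁)^{⋈(d-2)} ⋈ [2I-J-J'; -J; -J'; -I₂; -I₁]`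
  (the first display of the proof): the core `lapNNCore = diag(W, I₂, I₁)`, the uniform train
  `lapNNTrain` (boundary vectors `(1, 0, 0, 1, 1)`, `(2, -1, -1, -1, -1)`, every `d ≥ 0`), its
  automaton `vecMul_chainProd_lapNNCore` (states: the Laplace channels of Lem. 2.1,
  `𝟙[m = n = 2^k - 1]` and `𝟙[m = n = 0]`), `eval_lapNNTrain`, `qttMatrix_lapNNTrain`, the terminal
  cores `[I J' J I₂ I₁]`, `[2I-J-J'; -J; -J'; -I₂; -I₁]` (`nnFirst`, `nnLast`) and the three-factor
  form VERBATIM `laplaceNN_eq_nnFirst_mul_chainProd_mul_nnLast` (`d ≥ 2`); the entrywise forms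
  `eval_lapDNTrain`, `eval_lapNDTrain`, `eval_lapPTrain` of the representations of `QTTLaplace`;
* (LEMMA 2.2, FIRST TWO DISPLAYS, VERBATIM) the terminal cores `[I J' J I₂]`, `[2I-J-J'; -J; -J'; -I₂]`
  (`dnFirst`, `dnLast`) and `[I J' J I₁]`, `[2I-J-J'; -J; -J'; -I₁]` (`ndFirst`, `ndLast`) and the
  three-factor strong Kronecker products
  `Δ_DN^{(d)} = [I J' J I₂] ⋈ diag(W, I₂)^{⋈(d-2)} ⋈ [2I-J-J'; -J; -J'; -I₂]`,
  `Δ_ND^{(d)} = [I J' J I₁] ⋈ diag(W, I₁)^{⋈(d-2)} ⋈ [2I-J-J'; -J; -J'; -I₁]` read at the block entry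
  `((i₁…i_d), (j₁…j_d))` (`laplaceDN_eq_dnFirst_mul_chainProd_mul_dnLast`,
  `laplaceND_eq_ndFirst_mul_chainProd_mul_ndLast`, `d ≥ 2`; the uniform forms are
  `qttMatrix_lapDNTrain`, `qttMatrix_lapNDTrain` of `QTTLaplace`);
* (LEMMA 2.2, THIRD DISPLAY: THE TERMINAL RANK REDUCTION OF `Δ_NN^{(d)}`, "due to the fact that
  `I₁ + I₂ = I` we can reduce both the terminal ranks down to 4") the BOND MATRICES
  `M = [1 0 0 0 1; 0 1 0 0 0; 0 0 1 0 0; 0 0 0 1 -1]` (`nnL`, `[I J' J I₂] ⋈ M = [I J' J I₂ I₁]`: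
  `dnFirst_mul_nnL`) and `N = [1 0 0 0; 0 1 0 0; 0 0 1 0; 0 0 0 1; -½ ½ ½ -1]` (`nnR`,
  `N ⋈ [2I-J-J'; -J; -J'; -I₂] = [2I-J-J'; -J; -J'; -I₂; -I₁]`: `nnR_mul_dnLast`, the sweep where `½`
  enters), the intermediate display
  `Δ_NN^{(d)} = [I J' J I₂] ⋈ M ⋈ diag(W, I₂, I₁)^{⋈(d-2)} ⋈ N ⋈ [2I-J-J'; -J; -J'; -I₂]`
  (`laplaceNN_eq_dnFirst_mul_nnL_mul_chainProd_mul_nnR_mul_dnLast`, `d ≥ 2`), the merged cores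
  `[I J' J 0 I₁; 0 J 0 0 0; 0 0 J' 0 0; 0 0 0 I₂ -I₁] = M ⋈ diag(W, I₂, I₁)` (`nnSecond`, `nnSecond_eq`)
  and `[I J' J 0; 0 J 0 0; 0 0 J' 0; 0 0 0 I₂; -½I₁ ½I₁ ½I₁ -I₁] = diag(W, I₂, I₁) ⋈ N` (`nnPenult`,
  `nnPenult_eq`), the matrix identity between the five-factor and the three-factor products
  (`dnFirst_mul_nnSecond_mul_chainProd_mul_nnPenult_mul_dnLast`), and the lemma's display VERBATIM
  for `d ≥ 4`, over a field with `2 ≠ 0`: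
  `Δ_NN^{(d)} = [I J' J I₂] ⋈ [I J' J 0 I₁; 0 J 0 0 0; 0 0 J' 0 0; 0 0 0 I₂ -I₁]
     ⋈ diag(W, I₂, I₁)^{⋈(d-4)} ⋈ [I J' J 0; 0 J 0 0; 0 0 J' 0; 0 0 0 I₂; -½I₁ ½I₁ ½I₁ -I₁]
     ⋈ [2I-J-J'; -J; -J'; -I₂]`
  (`laplaceNN_eq_dnFirst_mul_nnSecond_mul_chainProd_mul_nnPenult_mul_dnLast`);
* (LEMMA 2.2, FOURTH DISPLAY: THE RANK REDUCTION OF `Δ_P^{(d)}` TO `2, 3, …, 3`) the terminal cores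
  `[I J' J J J']`, `[2I-J-J'; -J; -J'; -J; -J']` of the rank-`5` representation (`lapPFirst`,
  `lapPLast`; VERBATIM three-factor form `laplaceP_eq_lapPFirst_mul_chainProd_mul_lapPLast`, `d ≥ 2`),
  the `5 × 3` BOND MATRIX OF ONES `Z = [1 0 0; 0 1 0; 0 0 1; 0 1 0; 0 0 1]` (`perZ`) with
  `Z ⋈ [2I-J-J'; -J; -J'] = [2I-J-J'; -J; -J'; -J; -J']` (`perZ_mul_lapLast`) and THE SWEEP
  `diag(W, J, J') ⋈ Z = Z ⋈ W` (`lapPCore_mul_perZ`, along a chain: `chainProd_lapPCore_mul_perZ`),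
  the bond matrix `[1 0 0; 0 1 1]` (`perL`) with `[I J' J J J'] ⋈ Z = [I P] ⋈ [1 0 0; 0 1 1]`
  (`lapPFirst_mul_perZ`), the cores `[I P]` (`perFirst`) and `[I J' J; 0 J J'] = [1 0 0; 0 1 1] ⋈ W`
  (`perSecond`, `perSecond_eq`; `P = J + J'` is `blkP` of `QTTLaplaceInverse` over a field:
  `blkJ_add_blkJ'`), the matrix identities between the reduced and the rank-`5` products
  (`perFirst_mul_perL_mul_chainProd_mul_lapLast`, `perFirst_mul_perSecond_mul_chainProd_mul_lapLast`),
  the intermediate display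
  `Δ_P^{(d)} = [I P] ⋈ [1 0 0; 0 1 1] ⋈ W^{⋈(d-2)} ⋈ [2I-J-J'; -J; -J']`
  (`laplaceP_eq_perFirst_mul_perL_mul_chainProd_mul_lapLast`, `d ≥ 2`) and the lemma's display
  VERBATIM for `d ≥ 3` (over any commutative ring):
  `Δ_P^{(d)} = [I P] ⋈ [I J' J; 0 J J'] ⋈ W^{⋈(d-3)} ⋈ [2I-J-J'; -J; -J']`
  (`laplaceP_eq_perFirst_mul_perSecond_mul_chainProd_mul_lapLast`);
* (THEOREM 4.1, ONE-DIMENSIONAL LINES `Δ_NN^{(d)} : 4, 5 … 5, 4` AND `Δ_P^{(d)} : 2, 3 … 3`) the rank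
  profiles as bounds on unfolding ranks of the uniform trains over a field:
  `rank_unfolding_lapNNTrain_le` (`≤ 5` everywhere), `rank_unfolding_lapNNTrain_first_le` (`≤ 4`
  across the first bond, from `dnFirst_mul_nnL`), `rank_unfolding_lapNNTrain_last_le` (`≤ 4` across
  the last bond, from `nnR_mul_dnLast`, `2 ≠ 0`); `rank_unfolding_lapPTrain_le` (`≤ 3` at EVERY bond
  of the rank-`5` train `lapPTrain` of `QTTLaplace`, by the sweep) and
  `rank_unfolding_lapPTrain_first_le` (`≤ 2` across the first bond: the entry splits as
  `I(i₁,j₁)·x + P(i₁,j₁)·(y + z)`), the latter through the new general devices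
  `TensorTrain.eval_uniform_append` (the value of a uniform train at a concatenated configuration is
  the pairing `(α · G₀(s₀) ⋯ G_{k-1}(s_{k-1})) ⬝ (G_k(t₀) ⋯ G_{L-1}(t_{m-1}) · β)` of the swept
  boundary row and column) and `TensorTrain.rank_unfolding_uniform_le_of_dotProduct` (a two-sided
  factorisation `w(s) ⬝ v(t)` through `r` terms bounds the unfolding rank by `r`).  The lines
  `Δ_DD^{(d)} : 3 … 3` and `Δ_DN^{(d)}, Δ_ND^{(d)} : 4 … 4` are the bond dimensions of `lapTrain`,
  `lapDNTrain`, `lapNDTrain` (`TensorTrain.rank_unfolding_le` of `QuanticsTensorTrain`).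

Conventions as in `QTTLaplace` / `QTTLaplaceMulti`: digit pairs most significant first
(`quanticsEquiv`), indices from `0`; every train is in the uniform form (`TensorTrain.uniform`), the
paper's non-square terminal and merged cores appear as products of uniform cores with bond matrices
and boundary vectors (`nnSecond_eq`, `nnPenult_eq`, `perSecond_eq`, …), its rank drops as
unfolding-rank bounds.  For `N = 1` the matrix `laplaceNN 1` is `0`, in accordance with
`Δ_NN^{(d)} = Δ_DD^{(d)} - I₁^{⊗d} - I₂^{⊗d}` at `d = 0`.  The `4 × 5`, `5 × 4`, `5 × 3` and `2 × 3`
matrices of the proof of Lem. 2.2 are printed in the preprint with blank zero entries; the entries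
used here are the ones forced by the stated identities (`[I J' J I₂] ⋈ M = [I J' J I₂ I₁]`, …).

Not formalised / honest scope: the multi-dimensional supercores of Cor. 2.5–2.7 and the
corresponding lines of Thm. 4.1; minimality of the ranks (Rem. 4.2); the inverse (§3) beyond
`QTTLaplaceInverse`; §5.  Numbering `eqs. (4)–(7)`, `Lem. 2.1`, `Lem. 2.2`, `Thm. 4.1`, `Rem. 4.2`
follows the Max Planck Institute MIS Leipzig Preprint 75/2010 version of [KazeevKhoromskij2012].

References: V. A. Kazeev, B. N. Khoromskij, *Low-rank explicit QTT representation of the Laplace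
operator and its inverse*, SIAM J. Matrix Anal. Appl. 33 (2012) 742–758, MPI MIS Preprint 75/2010
(`KazeevKhoromskij2012`), eqs. (4)–(7), Lem. 2.2 and its proof, Thm. 4.1.

AI-produced formalisation (H21 engines group, seat eng-quad-2, 2026-08-23); no facts, no axioms
beyond Mathlib's, no `sorry`.
-/

open Matrix Finset

namespace Literature.LinearAlgebra.TensorNetworks

universe u

/-! ### Two general devices: the value at a concatenated configuration; two-sided factorisations -/

namespace TensorTrain

variable {K : Type u} [CommSemiring K] {σ : Type*}

/-- THE VALUE OF A UNIFORM TRAIN AT A CONCATENATED CONFIGURATION `(s, t)` is the pairing of the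
boundary row swept through the first `k` cores with the boundary column swept back through the
last `m` cores: `T(s, t) = (α · G₀(s₀) ⋯ G_{k-1}(s_{k-1})) ⬝ (G_k(t₀) ⋯ G_{k+m-1}(t_{m-1}) · β)`
(the entries of the unfolding matrix across the bond after site `k - 1`).
[cite: KazeevKhoromskij2012, Thm. 4.1] -/
theorem eval_uniform_append {n L : ℕ} (G : ℕ → σ → Matrix (Fin n) (Fin n) K) (α β : Fin n → K)
    (k m : ℕ) (h : k + m = L) (s : Fin k → σ) (t : Fin m → σ) :
    (uniform L n G α β).eval (fun i => Fin.append s t (i.cast h.symm)) =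
      α ᵥ* chainProd G k s ⬝ᵥ (chainProd (fun ℓ => G (k + ℓ)) m t *ᵥ β) := by
  have hr : (Matrix.of fun l j => (uniform L n G α β).segProd k m t l
        (j.cast (congrArg (uniform L n G α β).r h).symm)) *ᵥ (uniform L n G α β).rbdry =
      chainProd (fun ℓ => G (k + ℓ)) m t *ᵥ β := by
    rw [← segProd_uniform L G α β k m t]
    rfl
  rw [eval_append_eq_sum_bond _ k m h s t, hr, leftProd_uniform]
  rfl

/-- A TWO-SIDED FACTORISATION BOUNDS AN UNFOLDING RANK: if the pairing of the swept boundary row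
and column always splits as `w(s) ⬝ v(t)` through `r` terms, the unfolding matrix across that bond
has rank `≤ r` (it is `P · Qᵀ` with `P = (w(s))_s`, `Q = (v(t))_t` of width `r`; the rank-reduction
step of the cited proofs when the dependence among QTT blocks involves both neighbouring cores).
[cite: KazeevKhoromskij2012, Thm. 4.1] -/
theorem rank_unfolding_uniform_le_of_dotProduct {K : Type u} [Field K] {σ : Type*} [Fintype σ]
    {n r L : ℕ} (G : ℕ → σ → Matrix (Fin n) (Fin n) K) (α β : Fin n → K) (k m : ℕ)
    (h : k + m = L) (w : (Fin k → σ) → Fin r → K) (v : (Fin m → σ) → Fin r → K)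
    (hw : ∀ s t, α ᵥ* chainProd G k s ⬝ᵥ (chainProd (fun ℓ => G (k + ℓ)) m t *ᵥ β) =
      w s ⬝ᵥ v t) :
    (Matrix.of fun (s : Fin k → σ) (t : Fin m → σ) =>
        (uniform L n G α β).eval (fun i => Fin.append s t (i.cast h.symm))).rank ≤ r := by
  classical
  have hPQ : (Matrix.of fun (s : Fin k → σ) (t : Fin m → σ) =>
      (uniform L n G α β).eval (fun i => Fin.append s t (i.cast h.symm))) =
        Matrix.of w * (Matrix.of v)ᵀ := by
    ext s t
    rw [Matrix.of_apply, eval_uniform_append G α β k m h s t, hw s t, Matrix.mul_apply]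
    rfl
  rw [hPQ]
  calc (Matrix.of w * (Matrix.of v)ᵀ).rank ≤ (Matrix.of w).rank := Matrix.rank_mul_le_left _ _
    _ ≤ Fintype.card (Fin r) := Matrix.rank_le_card_width _
    _ = r := Fintype.card_fin r

end TensorTrain

/-! ### The Neumann Laplacian: the rank-`5` representation (proof of Lem. 2.2, first display) -/

section Neumann

variable (K : Type u) [CommRing K]

/-- THE NEUMANN LAPLACIAN `Δ_NN` of size `N`: `tridiag(-1, 2, -1)` with the FIRST AND THE LAST
diagonal entries lowered to `1` (eq. (4)); equivalently `Δ_DD - I₁^{⊗d} - I₂^{⊗d}` (proof of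
Lem. 2.2), which for `N = 1` gives the single entry `2 - 1 - 1 = 0`.
[cite: KazeevKhoromskij2012, eq. (4)] -/
def laplaceNN (N : ℕ) : Matrix (Fin N) (Fin N) K :=
  Matrix.of fun m n =>
    if (m : ℕ) = n then
      2 - (if (m : ℕ) = 0 then 1 else 0) - (if (m : ℕ) + 1 = N then 1 else 0)
    else if (n : ℕ) = m + 1 ∨ (m : ℕ) = n + 1 then -1 else 0

/-- The middle core `diag(W, I₂, I₁) = [I J' J 0 0; 0 J 0 0 0; 0 0 J' 0 0; 0 0 0 I₂ 0; 0 0 0 0 I₁]`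
of the rank-`5` representation of `Δ_NN^{(d)}` (proof of Lem. 2.2; also the middle core of the
lemma's reduced display).  [cite: KazeevKhoromskij2012, Lem. 2.2] -/
def lapNNCore (p : Fin 2 × Fin 2) : Matrix (Fin 5) (Fin 5) K :=
  !![blkI K p, blkJ' K p, blkJ K p, 0, 0; 0, blkJ K p, 0, 0, 0; 0, 0, blkJ' K p, 0, 0;
    0, 0, 0, blkI₂ K p, 0; 0, 0, 0, 0, blkI₁ K p]

/-- THE RANK-`5` TRAIN OF THE NEUMANN LAPLACIAN (proof of Lem. 2.2) in uniform form: cores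
`diag(W, I₂, I₁)`, boundary vectors `(1, 0, 0, 1, 1)` and `(2, -1, -1, -1, -1)`
(`[I J' J I₂ I₁] = (1,0,0,1,1) ⋈ diag(W, I₂, I₁)`,
`[2I-J-J'; -J; -J'; -I₂; -I₁] = diag(W, I₂, I₁) ⋈ (2,-1,-1,-1,-1)ᵀ`).
[cite: KazeevKhoromskij2012, Lem. 2.2] -/
def lapNNTrain (d : ℕ) : TensorTrain K (Fin 2 × Fin 2) d :=
  TensorTrain.uniform d 5 (fun _ => lapNNCore K) ![1, 0, 0, 1, 1] ![2, -1, -1, -1, -1]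

/-- States of the `Δ_NN` automaton at level `k`: the Laplace states of Lem. 2.1,
`𝟙[m = n = 2^k - 1]` (the `I₂` channel) and `𝟙[m = n = 0]` (the `I₁` channel).
[cite: KazeevKhoromskij2012, Lem. 2.2] -/
def lapNNVec (k m n : ℕ) : Fin 5 → K :=
  ![if m = n then 1 else 0, if m = n + 1 then 1 else 0, if n = m + 1 then 1 else 0,
    if m + 1 = 2 ^ k ∧ n + 1 = 2 ^ k then 1 else 0, if m = 0 ∧ n = 0 then 1 else 0]

/-- The first core `[I J' J I₂]` of `Δ_DN^{(d)}` (Lem. 2.2, a `1 × 4` core matrix; also the first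
core of the reduced `Δ_NN^{(d)}`).  [cite: KazeevKhoromskij2012, Lem. 2.2] -/
def dnFirst (p : Fin 2 × Fin 2) : Matrix (Fin 1) (Fin 4) K :=
  !![blkI K p, blkJ' K p, blkJ K p, blkI₂ K p]

/-- The last core `[2I-J-J'; -J; -J'; -I₂]` of `Δ_DN^{(d)}` (Lem. 2.2, `4 × 1`; also the last core of
the reduced `Δ_NN^{(d)}`).  [cite: KazeevKhoromskij2012, Lem. 2.2] -/
def dnLast (p : Fin 2 × Fin 2) : Matrix (Fin 4) (Fin 1) K :=
  !![2 * blkI K p - blkJ K p - blkJ' K p; -blkJ K p; -blkJ' K p; -blkI₂ K p]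

/-- The first core `[I J' J I₁]` of `Δ_ND^{(d)}` (Lem. 2.2, `1 × 4`).
[cite: KazeevKhoromskij2012, Lem. 2.2] -/
def ndFirst (p : Fin 2 × Fin 2) : Matrix (Fin 1) (Fin 4) K :=
  !![blkI K p, blkJ' K p, blkJ K p, blkI₁ K p]

/-- The last core `[2I-J-J'; -J; -J'; -I₁]` of `Δ_ND^{(d)}` (Lem. 2.2, `4 × 1`).
[cite: KazeevKhoromskij2012, Lem. 2.2] -/
def ndLast (p : Fin 2 × Fin 2) : Matrix (Fin 4) (Fin 1) K :=
  !![2 * blkI K p - blkJ K p - blkJ' K p; -blkJ K p; -blkJ' K p; -blkI₁ K p]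

/-- The first core `[I J' J I₂ I₁]` of the rank-`5` representation of `Δ_NN^{(d)}` (proof of
Lem. 2.2, `1 × 5`).  [cite: KazeevKhoromskij2012, Lem. 2.2] -/
def nnFirst (p : Fin 2 × Fin 2) : Matrix (Fin 1) (Fin 5) K :=
  !![blkI K p, blkJ' K p, blkJ K p, blkI₂ K p, blkI₁ K p]

/-- The last core `[2I-J-J'; -J; -J'; -I₂; -I₁]` of the rank-`5` representation of `Δ_NN^{(d)}`
(proof of Lem. 2.2, `5 × 1`).  [cite: KazeevKhoromskij2012, Lem. 2.2] -/
def nnLast (p : Fin 2 × Fin 2) : Matrix (Fin 5) (Fin 1) K :=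
  !![2 * blkI K p - blkJ K p - blkJ' K p; -blkJ K p; -blkJ' K p; -blkI₂ K p; -blkI₁ K p]

/-- The left bond matrix `M = [1 0 0 0 1; 0 1 0 0 0; 0 0 1 0 0; 0 0 0 1 -1]` of the terminal rank
reduction of `Δ_NN^{(d)}` (`[I J' J I₂] ⋈ M = [I J' J I₂ I₁]` since `I - I₂ = I₁`).
[cite: KazeevKhoromskij2012, Lem. 2.2] -/
def nnL : Matrix (Fin 4) (Fin 5) K :=
  !![1, 0, 0, 0, 1; 0, 1, 0, 0, 0; 0, 0, 1, 0, 0; 0, 0, 0, 1, -1]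

/-- The second core `[I J' J 0 I₁; 0 J 0 0 0; 0 0 J' 0 0; 0 0 0 I₂ -I₁] = M ⋈ diag(W, I₂, I₁)` of the
reduced representation of `Δ_NN^{(d)}` (Lem. 2.2, `4 × 5`).  [cite: KazeevKhoromskij2012, Lem. 2.2] -/
def nnSecond (p : Fin 2 × Fin 2) : Matrix (Fin 4) (Fin 5) K :=
  !![blkI K p, blkJ' K p, blkJ K p, 0, blkI₁ K p; 0, blkJ K p, 0, 0, 0; 0, 0, blkJ' K p, 0, 0;
    0, 0, 0, blkI₂ K p, -blkI₁ K p]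

variable {K}

/-- [folklore] One step of the `Δ_NN` automaton (bookkeeping case analysis). -/
private theorem lapNNVec_step (k m n : ℕ) (a a' : Fin 2) :
    lapNNVec K (k + 1) (2 * m + a) (2 * n + a') = lapNNVec K k m n ᵥ* lapNNCore K (a, a') := by
  ext j
  rw [lapNNVec, pow_succ]
  fin_cases a <;> fin_cases a' <;> fin_cases j <;>
    simp [lapNNVec, lapNNCore, blkI, blkJ, blkJ', blkI₁, blkI₂, Matrix.vecMul, dotProduct,
      Fin.sum_univ_five] <;>
    (try split_ifs) <;> first | rfl | omega

/-- The `Δ_NN` automaton: reading the digit pairs most significant first,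
`(1, 0, 0, 1, 1) · diag(W, I₂, I₁)(σ₀, μ₀) ⋯ diag(W, I₂, I₁)(σ_{d-1}, μ_{d-1}) =
(𝟙[m = n], 𝟙[m = n + 1], 𝟙[n = m + 1], 𝟙[m = n = 2^d - 1], 𝟙[m = n = 0])`.
[cite: KazeevKhoromskij2012, Lem. 2.2] -/
theorem vecMul_chainProd_lapNNCore (d : ℕ) (σ μ : Fin d → Fin 2) :
    ![(1 : K), 0, 0, 1, 1] ᵥ* TensorTrain.chainProd (fun _ => lapNNCore K) d (fun r => (σ r, μ r)) =
      lapNNVec K d (quanticsEquiv 2 d σ) (quanticsEquiv 2 d μ) := by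
  have h0 : lapNNVec K 0 0 0 = ![1, 0, 0, 1, 1] := by
    ext j; fin_cases j <;> simp [lapNNVec]
  rw [← h0]
  exact TensorTrain.vecMul_chainProd_of_digitStep (lapNNCore K) (lapNNVec K)
    (fun k m m' a a' _ _ => lapNNVec_step k m m' a a') d σ μ

/-- [folklore] Output of the `Δ_NN` automaton (bookkeeping case analysis). -/
private theorem lapNNVec_dotProduct (k m n : ℕ) :
    lapNNVec K k m n ⬝ᵥ ![2, -1, -1, -1, -1] =
      if m = n then 2 - (if m = 0 then 1 else 0) - (if m + 1 = 2 ^ k then 1 else 0)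
      else if n = m + 1 ∨ m = n + 1 then -1 else 0 := by
  simp [lapNNVec, dotProduct, Fin.sum_univ_five]
  split_ifs <;> first | omega | norm_num

/-- The value of the Neumann train at a string of digit pairs is the entry
`2·𝟙[m = n] - 𝟙[m = n + 1] - 𝟙[n = m + 1] - 𝟙[m = n = 2^d - 1] - 𝟙[m = n = 0]` of
`Δ_NN^{(d)} = Δ_DD^{(d)} - I₁^{⊗d} - I₂^{⊗d}`.  [cite: KazeevKhoromskij2012, Lem. 2.2] -/
theorem eval_lapNNTrain (d : ℕ) (σ μ : Fin d → Fin 2) :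
    (lapNNTrain K d).eval (fun r => (σ r, μ r)) =
      laplaceNN K (2 ^ d) (quanticsEquiv 2 d σ) (quanticsEquiv 2 d μ) := by
  rw [lapNNTrain, TensorTrain.eval_uniform, vecMul_chainProd_lapNNCore, laplaceNN, Matrix.of_apply]
  exact lapNNVec_dotProduct d _ _

/-- LEMMA 2.2 (proof), `Δ_NN`: THE NEUMANN LAPLACIAN OF SIZE `2^d` HAS THE RANK-`5` QTT
REPRESENTATION `Δ_NN^{(d)} = Δ_DD^{(d)} - I₁^{⊗d} - I₂^{⊗d} =
[I J' J I₂ I₁] ⋈ diag(W, I₂, I₁)^{⋈(d-2)} ⋈ [2I-J-J'; -J; -J'; -I₂; -I₁]` — uniform form, boundary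
vectors `(1, 0, 0, 1, 1)`, `(2, -1, -1, -1, -1)`, every `d ≥ 0`.
[cite: KazeevKhoromskij2012, Lem. 2.2] -/
theorem qttMatrix_lapNNTrain (d : ℕ) : (lapNNTrain K d).qttMatrix = laplaceNN K (2 ^ d) := by
  rw [TensorTrain.qttMatrix_eq_iff]
  exact eval_lapNNTrain d

/-- The values of the `Δ_DN` train (entrywise form of `qttMatrix_lapDNTrain`).
[cite: KazeevKhoromskij2012, Lem. 2.2] -/
theorem eval_lapDNTrain (d : ℕ) (σ μ : Fin d → Fin 2) :
    (lapDNTrain K d).eval (fun r => (σ r, μ r)) =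
      laplaceDN K (2 ^ d) (quanticsEquiv 2 d σ) (quanticsEquiv 2 d μ) := by
  rw [← TensorTrain.qttMatrix_apply, qttMatrix_lapDNTrain]

/-- The values of the `Δ_ND` train (entrywise form of `qttMatrix_lapNDTrain`).
[cite: KazeevKhoromskij2012, Lem. 2.2] -/
theorem eval_lapNDTrain (d : ℕ) (σ μ : Fin d → Fin 2) :
    (lapNDTrain K d).eval (fun r => (σ r, μ r)) =
      laplaceND K (2 ^ d) (quanticsEquiv 2 d σ) (quanticsEquiv 2 d μ) := by
  rw [← TensorTrain.qttMatrix_apply, qttMatrix_lapNDTrain]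

/-- The values of the rank-`5` `Δ_P` train (entrywise form of `qttMatrix_lapPTrain`).
[cite: KazeevKhoromskij2012, Lem. 2.2] -/
theorem eval_lapPTrain (d : ℕ) (σ μ : Fin d → Fin 2) :
    (lapPTrain K d).eval (fun r => (σ r, μ r)) =
      laplaceP K (2 ^ d) (quanticsEquiv 2 d σ) (quanticsEquiv 2 d μ) := by
  rw [← TensorTrain.qttMatrix_apply, qttMatrix_lapPTrain]

/-- [folklore] The entry of `row · M · column` is the bilinear pairing (bookkeeping). -/
private theorem row_mul_mul_col_apply {n : ℕ} (u v : Fin n → K) (M : Matrix (Fin n) (Fin n) K) :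
    (Matrix.of (fun (_ : Fin 1) j => u j) * M * Matrix.of (fun i (_ : Fin 1) => v i)) 0 0 =
      u ᵥ* M ⬝ᵥ v := by
  simp only [Matrix.mul_apply, Matrix.vecMul, dotProduct, Matrix.of_apply]

/-- [folklore] `[I J' J I₂] = (1,0,0,1) ⋈ diag(W, I₂)` (bookkeeping). -/
private theorem dnFirst_eq (p : Fin 2 × Fin 2) :
    dnFirst K p = Matrix.of fun (_ : Fin 1) j => (![(1 : K), 0, 0, 1] ᵥ* lapDNCore K p) j := by
  ext i j
  fin_cases i; fin_cases j <;>
    simp [dnFirst, lapDNCore, Matrix.vecMul, dotProduct, Fin.sum_univ_four]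

/-- [folklore] `[2I-J-J'; -J; -J'; -I₂] = diag(W, I₂) ⋈ (2,-1,-1,-1)ᵀ` (bookkeeping). -/
private theorem dnLast_eq (p : Fin 2 × Fin 2) :
    dnLast K p = Matrix.of fun i (_ : Fin 1) => (lapDNCore K p *ᵥ ![(2 : K), -1, -1, -1]) i := by
  ext i j
  fin_cases j; fin_cases i <;>
    simp [dnLast, lapDNCore, Matrix.mulVec, dotProduct, Fin.sum_univ_four]
  ring

/-- [folklore] `[I J' J I₁] = (1,0,0,1) ⋈ diag(W, I₁)` (bookkeeping). -/
private theorem ndFirst_eq (p : Fin 2 × Fin 2) :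
    ndFirst K p = Matrix.of fun (_ : Fin 1) j => (![(1 : K), 0, 0, 1] ᵥ* lapNDCore K p) j := by
  ext i j
  fin_cases i; fin_cases j <;>
    simp [ndFirst, lapNDCore, Matrix.vecMul, dotProduct, Fin.sum_univ_four]

/-- [folklore] `[2I-J-J'; -J; -J'; -I₁] = diag(W, I₁) ⋈ (2,-1,-1,-1)ᵀ` (bookkeeping). -/
private theorem ndLast_eq (p : Fin 2 × Fin 2) :
    ndLast K p = Matrix.of fun i (_ : Fin 1) => (lapNDCore K p *ᵥ ![(2 : K), -1, -1, -1]) i := by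
  ext i j
  fin_cases j; fin_cases i <;>
    simp [ndLast, lapNDCore, Matrix.mulVec, dotProduct, Fin.sum_univ_four]
  ring

/-- [folklore] `[I J' J I₂ I₁] = (1,0,0,1,1) ⋈ diag(W, I₂, I₁)` (bookkeeping). -/
private theorem nnFirst_eq (p : Fin 2 × Fin 2) :
    nnFirst K p = Matrix.of fun (_ : Fin 1) j => (![(1 : K), 0, 0, 1, 1] ᵥ* lapNNCore K p) j := by
  ext i j
  fin_cases i; fin_cases j <;>
    simp [nnFirst, lapNNCore, Matrix.vecMul, dotProduct, Fin.sum_univ_five]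

/-- [folklore] `[2I-J-J'; -J; -J'; -I₂; -I₁] = diag(W, I₂, I₁) ⋈ (2,-1,-1,-1,-1)ᵀ` (bookkeeping). -/
private theorem nnLast_eq (p : Fin 2 × Fin 2) :
    nnLast K p =
      Matrix.of fun i (_ : Fin 1) => (lapNNCore K p *ᵥ ![(2 : K), -1, -1, -1, -1]) i := by
  ext i j
  fin_cases j; fin_cases i <;>
    simp [nnLast, lapNNCore, Matrix.mulVec, dotProduct, Fin.sum_univ_five]
  ring

/-- LEMMA 2.2, `Δ_DN`, VERBATIM (`d = k + 2 ≥ 2`): the `((i₁…i_d), (j₁…j_d))` block entry of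
`[I J' J I₂] ⋈ [I J' J 0; 0 J 0 0; 0 0 J' 0; 0 0 0 I₂]^{⋈(d-2)} ⋈ [2I-J-J'; -J; -J'; -I₂]`, i.e. the
unique entry of `dnFirst(i₁,j₁) · diag(W,I₂)(i₂,j₂) ⋯ diag(W,I₂)(i_{d-1},j_{d-1}) · dnLast(i_d,j_d)`,
is `Δ_DN^{(d)}(m, n)`.  [cite: KazeevKhoromskij2012, Lem. 2.2] -/
theorem laplaceDN_eq_dnFirst_mul_chainProd_mul_dnLast (k : ℕ) (σ μ : Fin (k + 2) → Fin 2) :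
    (dnFirst K (σ 0, μ 0) *
        TensorTrain.chainProd (fun _ => lapDNCore K) k
          (fun r : Fin k => (σ r.succ.castSucc, μ r.succ.castSucc)) *
        dnLast K (σ (Fin.last (k + 1)), μ (Fin.last (k + 1)))) 0 0 =
      laplaceDN K (2 ^ (k + 2)) (quanticsEquiv 2 (k + 2) σ) (quanticsEquiv 2 (k + 2) μ) := by
  rw [← eval_lapDNTrain, lapDNTrain, TensorTrain.eval_uniform, TensorTrain.chainProd,
    TensorTrain.chainProd_succ_eq_mul, dnFirst_eq, dnLast_eq, row_mul_mul_col_apply]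
  simp only [← Matrix.vecMul_vecMul, Matrix.dotProduct_mulVec]
  rfl

/-- LEMMA 2.2, `Δ_ND`, VERBATIM (`d = k + 2 ≥ 2`): the block entry of
`[I J' J I₁] ⋈ [I J' J 0; 0 J 0 0; 0 0 J' 0; 0 0 0 I₁]^{⋈(d-2)} ⋈ [2I-J-J'; -J; -J'; -I₁]`
is `Δ_ND^{(d)}(m, n)`.  [cite: KazeevKhoromskij2012, Lem. 2.2] -/
theorem laplaceND_eq_ndFirst_mul_chainProd_mul_ndLast (k : ℕ) (σ μ : Fin (k + 2) → Fin 2) :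
    (ndFirst K (σ 0, μ 0) *
        TensorTrain.chainProd (fun _ => lapNDCore K) k
          (fun r : Fin k => (σ r.succ.castSucc, μ r.succ.castSucc)) *
        ndLast K (σ (Fin.last (k + 1)), μ (Fin.last (k + 1)))) 0 0 =
      laplaceND K (2 ^ (k + 2)) (quanticsEquiv 2 (k + 2) σ) (quanticsEquiv 2 (k + 2) μ) := by
  rw [← eval_lapNDTrain, lapNDTrain, TensorTrain.eval_uniform, TensorTrain.chainProd,
    TensorTrain.chainProd_succ_eq_mul, ndFirst_eq, ndLast_eq, row_mul_mul_col_apply]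
  simp only [← Matrix.vecMul_vecMul, Matrix.dotProduct_mulVec]
  rfl

/-- LEMMA 2.2 (proof), `Δ_NN`, FIRST DISPLAY VERBATIM (`d = k + 2 ≥ 2`): the block entry of
`[I J' J I₂ I₁] ⋈ diag(W, I₂, I₁)^{⋈(d-2)} ⋈ [2I-J-J'; -J; -J'; -I₂; -I₁]` is `Δ_NN^{(d)}(m, n)`.
[cite: KazeevKhoromskij2012, Lem. 2.2] -/
theorem laplaceNN_eq_nnFirst_mul_chainProd_mul_nnLast (k : ℕ) (σ μ : Fin (k + 2) → Fin 2) :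
    (nnFirst K (σ 0, μ 0) *
        TensorTrain.chainProd (fun _ => lapNNCore K) k
          (fun r : Fin k => (σ r.succ.castSucc, μ r.succ.castSucc)) *
        nnLast K (σ (Fin.last (k + 1)), μ (Fin.last (k + 1)))) 0 0 =
      laplaceNN K (2 ^ (k + 2)) (quanticsEquiv 2 (k + 2) σ) (quanticsEquiv 2 (k + 2) μ) := by
  rw [← eval_lapNNTrain, lapNNTrain, TensorTrain.eval_uniform, TensorTrain.chainProd,
    TensorTrain.chainProd_succ_eq_mul, nnFirst_eq, nnLast_eq, row_mul_mul_col_apply]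
  simp only [← Matrix.vecMul_vecMul, Matrix.dotProduct_mulVec]
  rfl

/-- `nnSecond = M ⋈ diag(W, I₂, I₁)`: the second core of the reduced representation is the bond
matrix `M` merged into a middle core (bookkeeping).  [cite: KazeevKhoromskij2012, Lem. 2.2] -/
theorem nnSecond_eq (p : Fin 2 × Fin 2) : nnSecond K p = nnL K * lapNNCore K p := by
  ext i j
  fin_cases i <;> fin_cases j <;>
    simp [nnSecond, nnL, lapNNCore, Matrix.mul_apply, Fin.sum_univ_five]

/-- THE LEFT TERMINAL REDUCTION OF `Δ_NN^{(d)}`: `[I J' J I₂] ⋈ M = [I J' J I₂ I₁]` ("due to the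
fact that `I₁ + I₂ = I`").  [cite: KazeevKhoromskij2012, Lem. 2.2] -/
theorem dnFirst_mul_nnL (p : Fin 2 × Fin 2) : dnFirst K p * nnL K = nnFirst K p := by
  obtain ⟨a, a'⟩ := p
  ext i j
  fin_cases i
  fin_cases a <;> fin_cases a' <;> fin_cases j <;>
    simp [dnFirst, nnL, nnFirst, blkI, blkJ, blkJ', blkI₁, blkI₂, Matrix.mul_apply,
      Fin.sum_univ_four]

/-- [folklore] Row form of the left terminal reduction: `((1,0,0,1) · diag(W,I₂)(p)) · M =
(1,0,0,1,1) · diag(W,I₂,I₁)(p)` (bookkeeping case analysis). -/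
private theorem vecMul_lapDNCore_vecMul_nnL (p : Fin 2 × Fin 2) :
    (![(1 : K), 0, 0, 1] ᵥ* lapDNCore K p) ᵥ* nnL K = ![(1 : K), 0, 0, 1, 1] ᵥ* lapNNCore K p := by
  obtain ⟨a, a'⟩ := p
  ext j
  fin_cases a <;> fin_cases a' <;> fin_cases j <;>
    simp [lapDNCore, nnL, lapNNCore, blkI, blkJ, blkJ', blkI₁, blkI₂, Matrix.vecMul, dotProduct,
      Fin.sum_univ_four, Fin.sum_univ_five]

end Neumann

/-! ### Lemma 2.2, `Δ_NN`: the terminal rank reduction (needs `½`) -/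

section NeumannReduced

variable (K : Type u) [Field K]

/-- The right bond matrix `N = [1 0 0 0; 0 1 0 0; 0 0 1 0; 0 0 0 1; -½ ½ ½ -1]` of the terminal rank
reduction of `Δ_NN^{(d)}` (`N ⋈ [2I-J-J'; -J; -J'; -I₂] = [2I-J-J'; -J; -J'; -I₂; -I₁]`).
[cite: KazeevKhoromskij2012, Lem. 2.2] -/
def nnR : Matrix (Fin 5) (Fin 4) K :=
  !![1, 0, 0, 0; 0, 1, 0, 0; 0, 0, 1, 0; 0, 0, 0, 1; -2⁻¹, 2⁻¹, 2⁻¹, -1]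

/-- The penultimate core `[I J' J 0; 0 J 0 0; 0 0 J' 0; 0 0 0 I₂; -½I₁ ½I₁ ½I₁ -I₁] =
diag(W, I₂, I₁) ⋈ N` of the reduced representation of `Δ_NN^{(d)}` (Lem. 2.2, `5 × 4`).
[cite: KazeevKhoromskij2012, Lem. 2.2] -/
def nnPenult (p : Fin 2 × Fin 2) : Matrix (Fin 5) (Fin 4) K :=
  !![blkI K p, blkJ' K p, blkJ K p, 0; 0, blkJ K p, 0, 0; 0, 0, blkJ' K p, 0; 0, 0, 0, blkI₂ K p;
    -2⁻¹ * blkI₁ K p, 2⁻¹ * blkI₁ K p, 2⁻¹ * blkI₁ K p, -blkI₁ K p]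

variable {K}

/-- `nnPenult = diag(W, I₂, I₁) ⋈ N` (bookkeeping).  [cite: KazeevKhoromskij2012, Lem. 2.2] -/
theorem nnPenult_eq (p : Fin 2 × Fin 2) : nnPenult K p = lapNNCore K p * nnR K := by
  ext i j
  fin_cases i <;> fin_cases j <;>
    simp [nnPenult, nnR, lapNNCore, Matrix.mul_apply, Fin.sum_univ_five] <;> ring

/-- THE RIGHT TERMINAL REDUCTION OF `Δ_NN^{(d)}` (the sweep where `½` enters):
`N ⋈ [2I-J-J'; -J; -J'; -I₂] = [2I-J-J'; -J; -J'; -I₂; -I₁]`, its fifth row being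
`-½(2I-J-J') - ½J - ½J' + I₂ = -I + I₂ = -I₁`.  Requires `2 ≠ 0` in `K`.
[cite: KazeevKhoromskij2012, Lem. 2.2] -/
theorem nnR_mul_dnLast [NeZero (2 : K)] (p : Fin 2 × Fin 2) : nnR K * dnLast K p = nnLast K p := by
  have h2 : (2 : K)⁻¹ * 2 = 1 := inv_mul_cancel₀ two_ne_zero
  obtain ⟨a, a'⟩ := p
  ext i j
  fin_cases j
  fin_cases a <;> fin_cases a' <;> fin_cases i <;>
    simp [nnR, dnLast, nnLast, blkI, blkJ, blkJ', blkI₁, blkI₂, Matrix.mul_apply,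
      Fin.sum_univ_four, h2]

/-- [folklore] Column form of the right terminal reduction:
`N · (diag(W,I₂)(p) · (2,-1,-1,-1)ᵀ) = diag(W,I₂,I₁)(p) · (2,-1,-1,-1,-1)ᵀ` (bookkeeping). -/
private theorem nnR_mulVec_lapDNCore_mulVec [NeZero (2 : K)] (p : Fin 2 × Fin 2) :
    nnR K *ᵥ (lapDNCore K p *ᵥ ![2, -1, -1, -1]) = lapNNCore K p *ᵥ ![2, -1, -1, -1, -1] := by
  have h2 : (2 : K)⁻¹ * 2 = 1 := inv_mul_cancel₀ two_ne_zero
  obtain ⟨a, a'⟩ := p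
  ext j
  fin_cases a <;> fin_cases a' <;> fin_cases j <;>
    simp [nnR, lapDNCore, lapNNCore, blkI, blkJ, blkJ', blkI₁, blkI₂, Matrix.mulVec, dotProduct,
      Fin.sum_univ_four, Fin.sum_univ_five, h2]

/-- LEMMA 2.2 (proof), `Δ_NN`, SECOND DISPLAY VERBATIM (`d = k + 2 ≥ 2`, `2 ≠ 0` in `K`): both
terminal ranks reduced to `4` by the bond matrices, the block entry of
`[I J' J I₂] ⋈ M ⋈ diag(W, I₂, I₁)^{⋈(d-2)} ⋈ N ⋈ [2I-J-J'; -J; -J'; -I₂]` is `Δ_NN^{(d)}(m, n)`.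
[cite: KazeevKhoromskij2012, Lem. 2.2] -/
theorem laplaceNN_eq_dnFirst_mul_nnL_mul_chainProd_mul_nnR_mul_dnLast [NeZero (2 : K)] (k : ℕ)
    (σ μ : Fin (k + 2) → Fin 2) :
    (dnFirst K (σ 0, μ 0) * nnL K *
        TensorTrain.chainProd (fun _ => lapNNCore K) k
          (fun r : Fin k => (σ r.succ.castSucc, μ r.succ.castSucc)) *
        nnR K * dnLast K (σ (Fin.last (k + 1)), μ (Fin.last (k + 1)))) 0 0 =
      laplaceNN K (2 ^ (k + 2)) (quanticsEquiv 2 (k + 2) σ) (quanticsEquiv 2 (k + 2) μ) := by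
  rw [dnFirst_mul_nnL, Matrix.mul_assoc _ (nnR K), nnR_mul_dnLast]
  exact laplaceNN_eq_nnFirst_mul_chainProd_mul_nnLast k σ μ

/-- The five-factor reduced product equals the three-factor rank-`5` product with the same digits:
merging `M` and `N` into the neighbouring middle cores (`nnSecond = M ⋈ C`, `nnPenult = C ⋈ N`,
`C = diag(W, I₂, I₁)`) and the terminal reductions `dnFirst ⋈ M = nnFirst`, `N ⋈ dnLast = nnLast`.
[cite: KazeevKhoromskij2012, Lem. 2.2] -/
theorem dnFirst_mul_nnSecond_mul_chainProd_mul_nnPenult_mul_dnLast [NeZero (2 : K)] (k : ℕ)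
    (p₀ p₁ p₂ p₃ : Fin 2 × Fin 2) (g : Fin k → Fin 2 × Fin 2) :
    dnFirst K p₀ * nnSecond K p₁ * TensorTrain.chainProd (fun _ => lapNNCore K) k g *
        nnPenult K p₂ * dnLast K p₃ =
      nnFirst K p₀ * (lapNNCore K p₁ * TensorTrain.chainProd (fun _ => lapNNCore K) k g) *
        lapNNCore K p₂ * nnLast K p₃ := by
  rw [nnSecond_eq, nnPenult_eq]
  simp only [Matrix.mul_assoc]
  rw [nnR_mul_dnLast, ← Matrix.mul_assoc (dnFirst K p₀), dnFirst_mul_nnL]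

/-- LEMMA 2.2 (KAZEEV–KHOROMSKIJ), `Δ_NN`, VERBATIM (`d = k + 4 ≥ 4`, over a field with `2 ≠ 0`):
THE NEUMANN LAPLACIAN HAS THE EXPLICIT QTT REPRESENTATION OF RANKS `4, 5, …, 5, 4`
`Δ_NN^{(d)} = [I J' J I₂] ⋈ [I J' J 0 I₁; 0 J 0 0 0; 0 0 J' 0 0; 0 0 0 I₂ -I₁]
   ⋈ [I J' J 0 0; 0 J 0 0 0; 0 0 J' 0 0; 0 0 0 I₂ 0; 0 0 0 0 I₁]^{⋈(d-4)}
   ⋈ [I J' J 0; 0 J 0 0; 0 0 J' 0; 0 0 0 I₂; -½I₁ ½I₁ ½I₁ -I₁] ⋈ [2I-J-J'; -J; -J'; -I₂]`: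
the `((i₁…i_d), (j₁…j_d))` block entry of the right-hand side — the unique entry of
`dnFirst(i₁,j₁) · nnSecond(i₂,j₂) · C(i₃,j₃) ⋯ C(i_{d-2},j_{d-2}) · nnPenult(i_{d-1},j_{d-1}) ·
dnLast(i_d,j_d)` — is `Δ_NN^{(d)}(m, n)`.  [cite: KazeevKhoromskij2012, Lem. 2.2] -/
theorem laplaceNN_eq_dnFirst_mul_nnSecond_mul_chainProd_mul_nnPenult_mul_dnLast [NeZero (2 : K)]
    (k : ℕ) (σ μ : Fin (k + 4) → Fin 2) :
    (dnFirst K (σ 0, μ 0) * nnSecond K (σ 1, μ 1) *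
        TensorTrain.chainProd (fun _ => lapNNCore K) k
          (fun r : Fin k => (σ r.succ.succ.castSucc.castSucc, μ r.succ.succ.castSucc.castSucc)) *
        nnPenult K (σ (Fin.last (k + 2)).castSucc, μ (Fin.last (k + 2)).castSucc) *
        dnLast K (σ (Fin.last (k + 3)), μ (Fin.last (k + 3)))) 0 0 =
      laplaceNN K (2 ^ (k + 4)) (quanticsEquiv 2 (k + 4) σ) (quanticsEquiv 2 (k + 4) μ) := by
  -- the chain over all `k + 4` sites
  have hchain : lapNNCore K (σ 0, μ 0) *
        (lapNNCore K (σ 1, μ 1) *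
          TensorTrain.chainProd (fun _ => lapNNCore K) k
            (fun r : Fin k =>
              (σ r.succ.succ.castSucc.castSucc, μ r.succ.succ.castSucc.castSucc))) *
        lapNNCore K (σ (Fin.last (k + 2)).castSucc, μ (Fin.last (k + 2)).castSucc) *
        lapNNCore K (σ (Fin.last (k + 3)), μ (Fin.last (k + 3))) =
      TensorTrain.chainProd (fun _ => lapNNCore K) (k + 4) (fun r => (σ r, μ r)) := by
    rw [TensorTrain.chainProd, TensorTrain.chainProd, TensorTrain.chainProd_succ_eq_mul,
      TensorTrain.chainProd_succ_eq_mul]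
    rfl
  rw [dnFirst_mul_nnSecond_mul_chainProd_mul_nnPenult_mul_dnLast,
    Matrix.mul_assoc (nnFirst K _) _ (lapNNCore K _), nnFirst_eq, nnLast_eq, row_mul_mul_col_apply,
    ← eval_lapNNTrain, lapNNTrain, TensorTrain.eval_uniform, ← hchain]
  simp only [← Matrix.vecMul_vecMul, Matrix.dotProduct_mulVec]

/-! ### Theorem 4.1, line `Δ_NN^{(d)} : 4, 5 … 5, 4` -/

/-- THEOREM 4.1 (line `Δ_NN^{(d)}`), THE `5`s: every unfolding matrix of the Neumann train has rank
`≤ 5`.  [cite: KazeevKhoromskij2012, Thm. 4.1] -/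
theorem rank_unfolding_lapNNTrain_le (d k m : ℕ) (h : k + m = d) :
    (Matrix.of fun (s : Fin k → Fin 2 × Fin 2) (t : Fin m → Fin 2 × Fin 2) =>
        (lapNNTrain K d).eval (fun i => Fin.append s t (i.cast h.symm))).rank ≤ 5 :=
  TensorTrain.rank_unfolding_le _ k m h

/-- THEOREM 4.1 (line `Δ_NN^{(d)}`), THE LEADING `4`: across the first bond the unfolding matrix
has rank `≤ 4` (the boundary row `[I J' J I₂ I₁](i₁,j₁) = [I J' J I₂](i₁,j₁) · M` lies in the row
space of `M`).  [cite: KazeevKhoromskij2012, Thm. 4.1] -/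
theorem rank_unfolding_lapNNTrain_first_le (d m : ℕ) (h : 1 + m = d) :
    (Matrix.of fun (s : Fin 1 → Fin 2 × Fin 2) (t : Fin m → Fin 2 × Fin 2) =>
        (lapNNTrain K d).eval (fun i => Fin.append s t (i.cast h.symm))).rank ≤ 4 :=
  TensorTrain.rank_unfolding_uniform_le_of_vecMul_chainProd _ _ _ 1 m h (nnL K)
    (fun s => ![(1 : K), 0, 0, 1] ᵥ* lapDNCore K (s (Fin.last 0))) fun s => by
      rw [TensorTrain.chainProd, TensorTrain.chainProd, Matrix.one_mul]
      exact (vecMul_lapDNCore_vecMul_nnL (s (Fin.last 0))).symm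

/-- THEOREM 4.1 (line `Δ_NN^{(d)}`), THE TRAILING `4`: across the last bond the unfolding matrix has
rank `≤ 4` (the boundary column `[2I-J-J'; -J; -J'; -I₂; -I₁](i_d,j_d) = N · [2I-J-J'; -J; -J'; -I₂]
(i_d,j_d)` lies in the column space of `N`; `2 ≠ 0` in `K`).  [cite: KazeevKhoromskij2012, Thm. 4.1] -/
theorem rank_unfolding_lapNNTrain_last_le [NeZero (2 : K)] (d k : ℕ) (h : k + 1 = d) :
    (Matrix.of fun (s : Fin k → Fin 2 × Fin 2) (t : Fin 1 → Fin 2 × Fin 2) =>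
        (lapNNTrain K d).eval (fun i => Fin.append s t (i.cast h.symm))).rank ≤ 4 :=
  TensorTrain.rank_unfolding_uniform_le_of_chainProd_mulVec _ _ _ k 1 h (nnR K)
    (fun t => lapDNCore K (t (Fin.last 0)) *ᵥ ![(2 : K), -1, -1, -1]) fun t => by
      rw [TensorTrain.chainProd, TensorTrain.chainProd, Matrix.one_mul]
      exact (nnR_mulVec_lapDNCore_mulVec (t (Fin.last 0))).symm

end NeumannReduced

/-! ### Lemma 2.2, `Δ_P`: the rank reduction of the periodic Laplacian to `2, 3, …, 3` -/

section Periodic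

variable (K : Type u) [CommRing K]

/-- The first core `[I J' J J J']` of the rank-`5` representation of `Δ_P^{(d)}` (proof of Lem. 2.2,
`1 × 5`).  [cite: KazeevKhoromskij2012, Lem. 2.2] -/
def lapPFirst (p : Fin 2 × Fin 2) : Matrix (Fin 1) (Fin 5) K :=
  !![blkI K p, blkJ' K p, blkJ K p, blkJ K p, blkJ' K p]

/-- The last core `[2I-J-J'; -J; -J'; -J; -J']` of the rank-`5` representation of `Δ_P^{(d)}`
(proof of Lem. 2.2, `5 × 1`).  [cite: KazeevKhoromskij2012, Lem. 2.2] -/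
def lapPLast (p : Fin 2 × Fin 2) : Matrix (Fin 5) (Fin 1) K :=
  !![2 * blkI K p - blkJ K p - blkJ' K p; -blkJ K p; -blkJ' K p; -blkJ K p; -blkJ' K p]

/-- The `5 × 3` bond matrix of ones `Z = [1 0 0; 0 1 0; 0 0 1; 0 1 0; 0 0 1]` of the rank reduction
of `Δ_P^{(d)}` (it folds the channels `J^{⊗}`, `J'^{⊗}` onto the channels `J`, `J'` of `W`).
[cite: KazeevKhoromskij2012, Lem. 2.2] -/
def perZ : Matrix (Fin 5) (Fin 3) K :=
  !![1, 0, 0; 0, 1, 0; 0, 0, 1; 0, 1, 0; 0, 0, 1]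

/-- The `2 × 3` bond matrix `[1 0 0; 0 1 1]` of the last step of the reduction of `Δ_P^{(d)}`
(`[I J' J J J'] ⋈ Z = [I P] ⋈ [1 0 0; 0 1 1]`).  [cite: KazeevKhoromskij2012, Lem. 2.2] -/
def perL : Matrix (Fin 2) (Fin 3) K :=
  !![1, 0, 0; 0, 1, 1]

/-- The first core `[I P]` of the reduced representation of `Δ_P^{(d)}` (Lem. 2.2, `1 × 2`), with
`P = [0 1; 1 0] = J + J'` (eq. (7); `blkJ_add_blkJ'`).  [cite: KazeevKhoromskij2012, Lem. 2.2] -/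
def perFirst (p : Fin 2 × Fin 2) : Matrix (Fin 1) (Fin 2) K :=
  !![blkI K p, blkJ K p + blkJ' K p]

/-- The second core `[I J' J; 0 J J'] = [1 0 0; 0 1 1] ⋈ W` of the reduced representation of
`Δ_P^{(d)}` (Lem. 2.2, `2 × 3`).  [cite: KazeevKhoromskij2012, Lem. 2.2] -/
def perSecond (p : Fin 2 × Fin 2) : Matrix (Fin 2) (Fin 3) K :=
  !![blkI K p, blkJ' K p, blkJ K p; 0, blkJ K p, blkJ' K p]

variable {K}

/-- [folklore] `[I J' J J J'] = (1,0,0,1,1) ⋈ diag(W, J, J')` (bookkeeping). -/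
private theorem lapPFirst_eq (p : Fin 2 × Fin 2) :
    lapPFirst K p = Matrix.of fun (_ : Fin 1) j => (![(1 : K), 0, 0, 1, 1] ᵥ* lapPCore K p) j := by
  ext i j
  fin_cases i; fin_cases j <;>
    simp [lapPFirst, lapPCore, Matrix.vecMul, dotProduct, Fin.sum_univ_five]

/-- [folklore] `[2I-J-J'; -J; -J'; -J; -J'] = diag(W, J, J') ⋈ (2,-1,-1,-1,-1)ᵀ` (bookkeeping). -/
private theorem lapPLast_eq (p : Fin 2 × Fin 2) :
    lapPLast K p =
      Matrix.of fun i (_ : Fin 1) => (lapPCore K p *ᵥ ![(2 : K), -1, -1, -1, -1]) i := by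
  ext i j
  fin_cases j; fin_cases i <;>
    simp [lapPLast, lapPCore, Matrix.mulVec, dotProduct, Fin.sum_univ_five]
  ring

/-- LEMMA 2.2 (proof), `Δ_P`, FIRST DISPLAY VERBATIM (`d = k + 2 ≥ 2`): the block entry of
`[I J' J J J'] ⋈ diag(W, J, J')^{⋈(d-2)} ⋈ [2I-J-J'; -J; -J'; -J; -J']` is `Δ_P^{(d)}(m, n)`.
[cite: KazeevKhoromskij2012, Lem. 2.2] -/
theorem laplaceP_eq_lapPFirst_mul_chainProd_mul_lapPLast (k : ℕ) (σ μ : Fin (k + 2) → Fin 2) :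
    (lapPFirst K (σ 0, μ 0) *
        TensorTrain.chainProd (fun _ => lapPCore K) k
          (fun r : Fin k => (σ r.succ.castSucc, μ r.succ.castSucc)) *
        lapPLast K (σ (Fin.last (k + 1)), μ (Fin.last (k + 1)))) 0 0 =
      laplaceP K (2 ^ (k + 2)) (quanticsEquiv 2 (k + 2) σ) (quanticsEquiv 2 (k + 2) μ) := by
  rw [← eval_lapPTrain, lapPTrain, TensorTrain.eval_uniform, TensorTrain.chainProd,
    TensorTrain.chainProd_succ_eq_mul, lapPFirst_eq, lapPLast_eq, row_mul_mul_col_apply]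
  simp only [← Matrix.vecMul_vecMul, Matrix.dotProduct_mulVec]
  rfl

/-- THE SWEEP OF THE REDUCTION OF `Δ_P^{(d)}`: `diag(W, J, J') ⋈ Z = Z ⋈ W` for every digit pair.
[cite: KazeevKhoromskij2012, Lem. 2.2] -/
theorem lapPCore_mul_perZ (p : Fin 2 × Fin 2) : lapPCore K p * perZ K = perZ K * lapCore K p := by
  ext i j
  fin_cases i <;> fin_cases j <;>
    simp [lapPCore, perZ, lapCore, Matrix.mul_apply, Fin.sum_univ_five, Fin.sum_univ_three]

/-- `Z ⋈ [2I-J-J'; -J; -J'] = [2I-J-J'; -J; -J'; -J; -J']`: the last core of the rank-`5`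
representation folds onto the last core of Lem. 2.1.  [cite: KazeevKhoromskij2012, Lem. 2.2] -/
theorem perZ_mul_lapLast (p : Fin 2 × Fin 2) : perZ K * lapLast K p = lapPLast K p := by
  ext i j
  fin_cases i <;> fin_cases j <;>
    simp [perZ, lapLast, lapPLast, Matrix.mul_apply, Fin.sum_univ_three]

/-- `[I J' J J J'] ⋈ Z = [I J'+J J+J'] = [I P] ⋈ [1 0 0; 0 1 1]`: the first core folds onto `[I P]`.
[cite: KazeevKhoromskij2012, Lem. 2.2] -/
theorem lapPFirst_mul_perZ (p : Fin 2 × Fin 2) : lapPFirst K p * perZ K = perFirst K p * perL K := by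
  ext i j
  fin_cases i; fin_cases j <;>
    simp [lapPFirst, perZ, perFirst, perL, Matrix.mul_apply, Fin.sum_univ_five, Fin.sum_univ_two]
  ring

/-- `perSecond = [1 0 0; 0 1 1] ⋈ W` (bookkeeping).  [cite: KazeevKhoromskij2012, Lem. 2.2] -/
theorem perSecond_eq (p : Fin 2 × Fin 2) : perSecond K p = perL K * lapCore K p := by
  ext i j
  fin_cases i <;> fin_cases j <;>
    simp [perSecond, perL, lapCore, Matrix.mul_apply, Fin.sum_univ_three]

/-- The sweep along a chain (the "`= … =`" of the cited proof): pushing `Z` through `m` cores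
`diag(W, J, J')` turns them into `m` cores `W`,
`diag(W,J,J')(t₀) ⋯ diag(W,J,J')(t_{m-1}) · Z = Z · W(t₀) ⋯ W(t_{m-1})`.
[cite: KazeevKhoromskij2012, Lem. 2.2] -/
theorem chainProd_lapPCore_mul_perZ :
    ∀ (m : ℕ) (t : Fin m → Fin 2 × Fin 2),
      TensorTrain.chainProd (fun _ => lapPCore K) m t * perZ K =
        perZ K * TensorTrain.chainProd (fun _ => lapCore K) m t
  | 0, _ => by simp [TensorTrain.chainProd]
  | m + 1, t => by
      rw [TensorTrain.chainProd, TensorTrain.chainProd, Matrix.mul_assoc, lapPCore_mul_perZ,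
        ← Matrix.mul_assoc, chainProd_lapPCore_mul_perZ m (Fin.init t), Matrix.mul_assoc]

/-- The four-factor product with the bond matrix equals the three-factor rank-`5` product with the
same digits: `[I P] ⋈ [1 0 0; 0 1 1] ⋈ W(g) ⋈ [2I-J-J'; -J; -J'] =
[I J' J J J'] ⋈ diag(W,J,J')(g) ⋈ [2I-J-J'; -J; -J'; -J; -J']`.  [cite: KazeevKhoromskij2012, Lem. 2.2] -/
theorem perFirst_mul_perL_mul_chainProd_mul_lapLast (k : ℕ) (p₀ p₁ : Fin 2 × Fin 2)
    (g : Fin k → Fin 2 × Fin 2) :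
    perFirst K p₀ * perL K * TensorTrain.chainProd (fun _ => lapCore K) k g * lapLast K p₁ =
      lapPFirst K p₀ * TensorTrain.chainProd (fun _ => lapPCore K) k g * lapPLast K p₁ := by
  rw [← perZ_mul_lapLast, ← Matrix.mul_assoc _ (perZ K) (lapLast K p₁),
    Matrix.mul_assoc (lapPFirst K p₀) _ (perZ K), chainProd_lapPCore_mul_perZ,
    ← Matrix.mul_assoc (lapPFirst K p₀), lapPFirst_mul_perZ]

/-- LEMMA 2.2 (proof), `Δ_P`, PENULTIMATE DISPLAY VERBATIM (`d = k + 2 ≥ 2`): the block entry of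
`[I P] ⋈ [1 0 0; 0 1 1] ⋈ W^{⋈(d-2)} ⋈ [2I-J-J'; -J; -J']` is `Δ_P^{(d)}(m, n)`.
[cite: KazeevKhoromskij2012, Lem. 2.2] -/
theorem laplaceP_eq_perFirst_mul_perL_mul_chainProd_mul_lapLast (k : ℕ) (σ μ : Fin (k + 2) → Fin 2) :
    (perFirst K (σ 0, μ 0) * perL K *
        TensorTrain.chainProd (fun _ => lapCore K) k
          (fun r : Fin k => (σ r.succ.castSucc, μ r.succ.castSucc)) *
        lapLast K (σ (Fin.last (k + 1)), μ (Fin.last (k + 1)))) 0 0 =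
      laplaceP K (2 ^ (k + 2)) (quanticsEquiv 2 (k + 2) σ) (quanticsEquiv 2 (k + 2) μ) := by
  rw [perFirst_mul_perL_mul_chainProd_mul_lapLast]
  exact laplaceP_eq_lapPFirst_mul_chainProd_mul_lapPLast k σ μ

/-- The four-factor reduced product equals the three-factor rank-`5` product with the same digits:
`[I P](p₀) · [I J' J; 0 J J'](p₁) · W(g) · [2I-J-J'; -J; -J'](p₂) =
[I J' J J J'](p₀) · (diag(W,J,J')(p₁) · diag(W,J,J')(g)) · [2I-J-J'; -J; -J'; -J; -J'](p₂)`.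
[cite: KazeevKhoromskij2012, Lem. 2.2] -/
theorem perFirst_mul_perSecond_mul_chainProd_mul_lapLast (k : ℕ) (p₀ p₁ p₂ : Fin 2 × Fin 2)
    (g : Fin k → Fin 2 × Fin 2) :
    perFirst K p₀ * perSecond K p₁ * TensorTrain.chainProd (fun _ => lapCore K) k g * lapLast K p₂ =
      lapPFirst K p₀ * (lapPCore K p₁ * TensorTrain.chainProd (fun _ => lapPCore K) k g) *
        lapPLast K p₂ := by
  have hs : lapPCore K p₁ * TensorTrain.chainProd (fun _ => lapPCore K) k g * perZ K =
      perZ K * (lapCore K p₁ * TensorTrain.chainProd (fun _ => lapCore K) k g) := by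
    have h := chainProd_lapPCore_mul_perZ (K := K) (k + 1) (Fin.cons (α := fun _ => Fin 2 × Fin 2) p₁ g)
    rw [TensorTrain.chainProd_succ_eq_mul, TensorTrain.chainProd_succ_eq_mul, Fin.cons_zero,
      Fin.tail_cons] at h
    exact h
  rw [perSecond_eq, ← perZ_mul_lapLast, ← Matrix.mul_assoc _ (perZ K) (lapLast K p₂),
    Matrix.mul_assoc (lapPFirst K p₀) _ (perZ K), hs, ← Matrix.mul_assoc (lapPFirst K p₀),
    lapPFirst_mul_perZ]
  simp only [Matrix.mul_assoc]

/-- LEMMA 2.2 (KAZEEV–KHOROMSKIJ), `Δ_P`, VERBATIM (`d = k + 3 ≥ 3`, over any commutative ring):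
THE PERIODIC LAPLACIAN HAS THE EXPLICIT QTT REPRESENTATION OF RANKS `2, 3, …, 3`
`Δ_P^{(d)} = [I P] ⋈ [I J' J; 0 J J'] ⋈ [I J' J; 0 J 0; 0 0 J']^{⋈(d-3)} ⋈ [2I-J-J'; -J; -J']`:
the `((i₁…i_d), (j₁…j_d))` block entry of the right-hand side — the unique entry of
`perFirst(i₁,j₁) · perSecond(i₂,j₂) · W(i₃,j₃) ⋯ W(i_{d-1},j_{d-1}) · lapLast(i_d,j_d)` — is
`Δ_P^{(d)}(m, n)`.  [cite: KazeevKhoromskij2012, Lem. 2.2] -/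
theorem laplaceP_eq_perFirst_mul_perSecond_mul_chainProd_mul_lapLast (k : ℕ)
    (σ μ : Fin (k + 3) → Fin 2) :
    (perFirst K (σ 0, μ 0) * perSecond K (σ 1, μ 1) *
        TensorTrain.chainProd (fun _ => lapCore K) k
          (fun r : Fin k => (σ r.succ.succ.castSucc, μ r.succ.succ.castSucc)) *
        lapLast K (σ (Fin.last (k + 2)), μ (Fin.last (k + 2)))) 0 0 =
      laplaceP K (2 ^ (k + 3)) (quanticsEquiv 2 (k + 3) σ) (quanticsEquiv 2 (k + 3) μ) := by
  -- the chain over all `k + 3` sites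
  have hchain : lapPCore K (σ 0, μ 0) *
        (lapPCore K (σ 1, μ 1) *
          TensorTrain.chainProd (fun _ => lapPCore K) k
            (fun r : Fin k => (σ r.succ.succ.castSucc, μ r.succ.succ.castSucc))) *
        lapPCore K (σ (Fin.last (k + 2)), μ (Fin.last (k + 2))) =
      TensorTrain.chainProd (fun _ => lapPCore K) (k + 3) (fun r => (σ r, μ r)) := by
    rw [TensorTrain.chainProd, TensorTrain.chainProd_succ_eq_mul, TensorTrain.chainProd_succ_eq_mul]
    rfl
  rw [perFirst_mul_perSecond_mul_chainProd_mul_lapLast, lapPFirst_eq, lapPLast_eq,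
    row_mul_mul_col_apply, ← eval_lapPTrain, lapPTrain, TensorTrain.eval_uniform, ← hchain]
  simp only [← Matrix.vecMul_vecMul, Matrix.dotProduct_mulVec]

end Periodic

/-! ### Theorem 4.1, line `Δ_P^{(d)} : 2, 3 … 3` (for the rank-`5` train `lapPTrain`) -/

section PeriodicRanks

variable {K : Type u} [Field K]

/-- Over a field, the block `P = [0 1; 1 0]` of eq. (7) (`blkP` of `QTTLaplaceInverse`) is
`J + J'`.  [cite: KazeevKhoromskij2012, eq. (7)] -/
theorem blkJ_add_blkJ' (p : Fin 2 × Fin 2) : blkJ K p + blkJ' K p = blkP K p := by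
  obtain ⟨a, a'⟩ := p
  fin_cases a <;> fin_cases a' <;> simp [blkJ, blkJ', blkP]

/-- [folklore] `Z · (2,-1,-1)ᵀ = (2,-1,-1,-1,-1)ᵀ`: the right boundary vector of the rank-`5` train
folds onto that of Lem. 2.1 (bookkeeping). -/
private theorem perZ_mulVec : perZ K *ᵥ ![(2 : K), -1, -1] = ![2, -1, -1, -1, -1] := by
  ext j
  fin_cases j <;> simp [perZ, Matrix.mulVec, dotProduct, Fin.sum_univ_three]

/-- [folklore] At the first bond the pairing splits through TWO terms:
`(I, J', J, J, J')(p) ⬝ (Z u) = I(p)·u₀ + P(p)·(u₁ + u₂)` (bookkeeping case analysis). -/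
private theorem vecMul_lapPCore_dotProduct_perZ_mulVec (p : Fin 2 × Fin 2) (u : Fin 3 → K) :
    ![(1 : K), 0, 0, 1, 1] ᵥ* lapPCore K p ⬝ᵥ (perZ K *ᵥ u) =
      ![blkI K p, blkJ K p + blkJ' K p] ⬝ᵥ ![u 0, u 1 + u 2] := by
  simp [lapPCore, perZ, Matrix.vecMul, Matrix.mulVec, dotProduct, Fin.sum_univ_five,
    Fin.sum_univ_three, Fin.sum_univ_two]
  ring

/-- THEOREM 4.1 (line `Δ_P^{(d)}`), THE `3`s: EVERY unfolding matrix of the rank-`5` periodic train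
`[I J' J J J'] ⋈ diag(W,J,J')^{⋈(d-2)} ⋈ [2I-J-J'; -J; -J'; -J; -J']` has rank `≤ 3` — the boundary
column swept back through any number of cores lies in the column space of `Z`
(`diag(W,J,J')(t) ⋯ · (2,-1,-1,-1,-1)ᵀ = Z · (W(t) ⋯ · (2,-1,-1)ᵀ)`, the sweep of Lem. 2.2).
[cite: KazeevKhoromskij2012, Thm. 4.1] -/
theorem rank_unfolding_lapPTrain_le (d k m : ℕ) (h : k + m = d) :
    (Matrix.of fun (s : Fin k → Fin 2 × Fin 2) (t : Fin m → Fin 2 × Fin 2) =>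
        (lapPTrain K d).eval (fun i => Fin.append s t (i.cast h.symm))).rank ≤ 3 :=
  TensorTrain.rank_unfolding_uniform_le_of_chainProd_mulVec _ _ _ k m h (perZ K)
    (fun t => TensorTrain.chainProd (fun _ => lapCore K) m t *ᵥ ![(2 : K), -1, -1]) fun t => by
      rw [← perZ_mulVec]
      simp only [Matrix.mulVec_mulVec]
      rw [chainProd_lapPCore_mul_perZ]

/-- THEOREM 4.1 (line `Δ_P^{(d)}`), THE LEADING `2`: across the first bond the unfolding matrix of
the periodic train has rank `≤ 2` — its entries split as `I(i₁,j₁)·x(t) + P(i₁,j₁)·(y(t) + z(t))`,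
the content of the first core `[I P]` of Lem. 2.2.  [cite: KazeevKhoromskij2012, Thm. 4.1] -/
theorem rank_unfolding_lapPTrain_first_le (d m : ℕ) (h : 1 + m = d) :
    (Matrix.of fun (s : Fin 1 → Fin 2 × Fin 2) (t : Fin m → Fin 2 × Fin 2) =>
        (lapPTrain K d).eval (fun i => Fin.append s t (i.cast h.symm))).rank ≤ 2 :=
  TensorTrain.rank_unfolding_uniform_le_of_dotProduct _ _ _ 1 m h
    (fun s => ![blkI K (s (Fin.last 0)), blkJ K (s (Fin.last 0)) + blkJ' K (s (Fin.last 0))])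
    (fun t => ![(TensorTrain.chainProd (fun _ => lapCore K) m t *ᵥ ![(2 : K), -1, -1]) 0,
      (TensorTrain.chainProd (fun _ => lapCore K) m t *ᵥ ![(2 : K), -1, -1]) 1 +
        (TensorTrain.chainProd (fun _ => lapCore K) m t *ᵥ ![(2 : K), -1, -1]) 2])
    fun s t => by
      rw [TensorTrain.chainProd, TensorTrain.chainProd, Matrix.one_mul, ← perZ_mulVec]
      simp only [Matrix.mulVec_mulVec]
      rw [chainProd_lapPCore_mul_perZ, ← Matrix.mulVec_mulVec]
      exact vecMul_lapPCore_dotProduct_perZ_mulVec _ _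

end PeriodicRanks

end Literature.LinearAlgebra.TensorNetworks
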